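import Literature.AlgebraicGeometry.Motives.GrassmannianOneProjective
import Literature.AlgebraicGeometry.Morphisms.GeometricallyIrreducibleOfChartFamily
import Mathlib.AlgebraicGeometry.AffineSpace
import HarnessLib

/-!
# `Gr₁(L) → Spec ℤ` is geometrically irreducible

Topic `AlgebraicGeometry/Motives`; namespace `Literature.AlgebraicGeometry.Motives.Grassmannian`. THEOREMS ONLY (no definition, no instance,
no notation, no named fact, no `sorry`).

For a free abelian group `L` with a NON-EMPTY basis `b : J → L`, the structure morphism of the rank-one Grassmannian scheme
`grassmannianScheme L 1 → ⊤ = Spec ℤ` is GEOMETRICALLY IRREDUCIBLE (`geometricallyIrreducible_terminal_from_one`): the fibre over a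
field `K` is `Gr₁(K^J) = ℙ(K^J)`, irreducible. Proof by the family chart criterion ★
`Morphisms/GeometricallyIrreducibleOfChartFamily.geometricallyIrreducible_of_isOpenImmersion_family` applied to the standard charts
`U_j = Spec ℤ[X^{(j)}] ≅ 𝔸^{J∖j}_ℤ` (★ `chartOpenCover`): every chart is an affine space over `Spec ℤ`, hence geometrically irreducible
(Mathlib `AffineSpace`), and for every field `K` the `K`-point of `U_j` with all coordinates `1` lies in every `U_l` (the overlap
`U_j ∩ U_l` pulled back to `U_j` is `D(c_{jl})` with `c_{jl} ∈ {1, X_l}`, ★ `preimage_opensRange_chartι_one`,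
`chartCoordMap_one_self`, `chartCoordMap_one_of_ne`). This is the last input of ★
`Motives/ProjectiveBundleOfQuotientSmoothProjective.projectiveBundleOfGloballyGeneratedQuotient_of_geometricallyIrreducible_of_nonempty`,
whence **`projectiveBundleOfGloballyGeneratedQuotient_holds : ProjectiveBundleOfGloballyGeneratedQuotient`** — in the sequel file.

## References
* [GortzWedhorn2020] U. Görtz, T. Wedhorn, *Algebraic Geometry I*, 2nd ed. (2020), (8.4)–(8.6), Cor. 8.15, Exercise 2.9.
* [Hartshorne1977] R. Hartshorne, *Algebraic Geometry* (1977), II Thm. 7.1 (the charts `X_i ∩ X_j = X_{s_j/s_i}`).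
* [StacksProject] The Stacks project, Tag 089T.
-/

universe u

set_option backward.isDefEq.respectTransparency false

open CategoryTheory CategoryTheory.Limits Opposite TopologicalSpace _root_.AlgebraicGeometry

namespace Literature.AlgebraicGeometry.Motives.Grassmannian

/-! ## §1 The charts are geometrically irreducible over `Spec ℤ` -/

/-- **`Spec ℤ[x_σ] → ⊤` is geometrically irreducible** (an affine space over `Spec ℤ`; Mathlib `AffineSpace`).
[cite: GortzWedhorn2020, (8.4)] -/
theorem geometricallyIrreducible_terminal_from_Spec_mvPolynomial (σ : Type u) :
    GeometricallyIrreducible (terminal.from (Spec (CommRingCat.of (MvPolynomial σ ℤ)))) := by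
  haveI : IsZariskiLocalAtTarget @GeometricallyIrreducible :=
    GeometricallyIrreducible.eq_geometrically ▸ inferInstance
  -- `terminal.from (Spec ℤ)` is an isomorphism, so `𝔸^σ_ℤ → ⊤` is geometrically irreducible
  haveI : IsIso (terminal.from (Spec (CommRingCat.of (ULift.{u} ℤ)))) :=
    ⟨⟨specULiftZIsTerminal.from _, specULiftZIsTerminal.hom_ext _ _, terminal.hom_ext _ _⟩⟩
  have h1 : GeometricallyIrreducible (terminal.from (𝔸(σ; Spec (CommRingCat.of (ULift.{u} ℤ))))) := by
    rw [show terminal.from _ = (𝔸(σ; Spec (CommRingCat.of (ULift.{u} ℤ))) ↘ Spec (CommRingCat.of (ULift.{u} ℤ))) ≫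
      terminal.from _ from terminal.hom_ext _ _,
      MorphismProperty.cancel_right_of_respectsIso (P := @GeometricallyIrreducible)]
    infer_instance
  -- `Spec ℤ[x_σ] ≅ 𝔸^σ_{Spec (ULift ℤ)}`
  let e : Spec (CommRingCat.of (MvPolynomial σ ℤ)) ⟶ 𝔸(σ; Spec (CommRingCat.of (ULift.{u} ℤ))) :=
    Spec.map (MvPolynomial.mapEquiv σ ULift.ringEquiv.{0, u}).toCommRingCatIso.hom ≫
      (AffineSpace.SpecIso σ (CommRingCat.of (ULift.{u} ℤ))).inv
  haveI : IsIso e := by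
    unfold e
    infer_instance
  rw [show terminal.from (Spec (CommRingCat.of (MvPolynomial σ ℤ))) = e ≫ terminal.from _ from terminal.hom_ext _ _,
    MorphismProperty.cancel_left_of_respectsIso (P := @GeometricallyIrreducible)]
  exact h1

/-- The chart `Spec ℤ[X^{(I)}] → ⊤` is geometrically irreducible. [cite: GortzWedhorn2020, (8.4)] -/
theorem geometricallyIrreducible_terminal_from_chartScheme (k : ℕ) {J : Type u} (I : Fin k → J) :
    GeometricallyIrreducible (terminal.from (chartScheme k I)) :=
  geometricallyIrreducible_terminal_from_Spec_mvPolynomial _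

/-! ## §2 The all-ones field point of a chart lies in every chart -/

section RankOne

variable (M : Type u) [AddCommGroup M] {J : Type u} (b : Module.Basis J ℤ M) [(grassmannianSheaf M 1).obj.IsRepresentable]

/-- A one-element frame `Fin 1 → J` is injective. [folklore] -/
private theorem inj_one (j : J) : Function.Injective (fun _ : Fin 1 => j) := Function.injective_of_subsingleton _

/-- **The `K`-point of the chart `U_j` with all coordinates `1` lies in every chart `U_l`**: under the evaluation `X ↦ 1` the
transition coordinate `c_{jl} ∈ {1, X_l}` goes to `1 ≠ 0`. [cite: Hartshorne1977, II Thm. 7.1] [cite: StacksProject, Tag 089T] -/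
theorem allOnes_mem_range_chartι (K : Type u) [Field K] (j l : J) (p : Spec (CommRingCat.of K)) :
    (Spec.map (chartRingHom 1 (fun _ : Fin 1 => j) (A := CommRingCat.of K) (fun _ => 1)) ≫
        (chartOpenCover 1 M b).f ⟨fun _ => j, inj_one j⟩).base p ∈
      Set.range ((chartOpenCover 1 M b).f ⟨fun _ => l, inj_one l⟩).base := by
  set a := Spec.map (chartRingHom 1 (fun _ : Fin 1 => j) (A := CommRingCat.of K) (fun _ => 1)) with ha
  have hmem : a.base p ∈ (chartOpenCover 1 M b).f ⟨fun _ => j, inj_one j⟩ ⁻¹ᵁ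
      ((chartOpenCover 1 M b).f ⟨fun _ => l, inj_one l⟩).opensRange := by
    rw [preimage_opensRange_chartι_one M b j l]
    change a.base p ∈ PrimeSpectrum.basicOpen _
    rw [PrimeSpectrum.mem_basicOpen, ha, Spec.map_apply, PrimeSpectrum.comap_asIdeal, Ideal.mem_comap,
      Ideal.eq_bot_of_prime p.asIdeal, Ideal.mem_bot]
    by_cases hlj : l = j
    · subst hlj
      rw [chartCoordMap_one_self, map_one]
      exact one_ne_zero
    · rw [chartCoordMap_one_of_ne M b hlj]
      change MvPolynomial.eval₂Hom (Int.castRingHom K) (fun _ => (1 : K)) (MvPolynomial.X _) ≠ 0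
      rw [MvPolynomial.coe_eval₂Hom, MvPolynomial.eval₂_X]
      exact one_ne_zero
  exact hmem

/-! ## §3 `Gr₁(L) → Spec ℤ` is geometrically irreducible -/

include b in
/-- **`grassmannianScheme L 1 → ⊤` IS GEOMETRICALLY IRREDUCIBLE** for a free `L` with a non-empty basis.
[cite: GortzWedhorn2020, (8.4) and Exercise 2.9] [cite: Hartshorne1977, II Thm. 7.1] -/
theorem geometricallyIrreducible_terminal_from_one [Nonempty J] :
    GeometricallyIrreducible (terminal.from (grassmannianScheme M 1)) := by
  let 𝒲 : Over (⊤_ Scheme.{u}) := Over.mk (terminal.from (grassmannianScheme M 1))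
  let 𝒱 : J → Over (⊤_ Scheme.{u}) := fun j => Over.mk (terminal.from (chartScheme 1 (fun _ : Fin 1 => j)))
  let i : ∀ j, 𝒱 j ⟶ 𝒲 := fun j =>
    Over.homMk ((chartOpenCover 1 M b).f ⟨fun _ => j, inj_one j⟩) (terminal.hom_ext _ _)
  haveI : ∀ j, IsOpenImmersion (i j).left := fun j => by
    change IsOpenImmersion ((chartOpenCover 1 M b).f _)
    infer_instance
  haveI : ∀ j, GeometricallyIrreducible (𝒱 j).hom := fun j =>
    geometricallyIrreducible_terminal_from_chartScheme 1 (fun _ : Fin 1 => j)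
  have hcover : ⋃ j, Set.range (i j).left.base = Set.univ := by
    refine Set.eq_univ_of_forall fun y => ?_
    obtain ⟨⟨I, hI⟩, x, hx⟩ : ∃ I x, ((chartOpenCover 1 M b).f I).base x = y := (chartOpenCover 1 M b).exists_eq y
    obtain ⟨j, hj⟩ : ∃ j, ∀ q, I q = j := ⟨I 0, fun q => by rw [Subsingleton.elim q 0]⟩
    have hI' : I = fun _ => j := funext hj
    subst hI'
    exact Set.mem_iUnion.mpr ⟨j, x, hx⟩
  refine Literature.AlgebraicGeometry.Morphisms.geometricallyIrreducible_of_isOpenImmersion_family (𝒲 := 𝒲) 𝒱 i hcover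
    fun K _ y j l => ?_
  refine ⟨Spec.map (chartRingHom 1 (fun _ : Fin 1 => j) (A := CommRingCat.of K) (fun _ => 1)) ≫
      (chartOpenCover 1 M b).f ⟨fun _ => j, inj_one j⟩, terminal.hom_ext _ _, ⟨⊥, Ideal.isPrime_bot⟩, ?_, ?_⟩
  · exact ⟨(Spec.map (chartRingHom 1 (fun _ : Fin 1 => j) (A := CommRingCat.of K) (fun _ => 1))).base ⟨⊥, Ideal.isPrime_bot⟩,
      rfl⟩
  · exact allOnes_mem_range_chartι M b K j l ⟨⊥, Ideal.isPrime_bot⟩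

end RankOne

end Literature.AlgebraicGeometry.Motives.Grassmannian
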